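import Literature.Probability.NegativeDependence.FederMihail
import Literature.Combinatorics.StablePolynomials.NegativeCorrelation
import Literature.Combinatorics.StablePolynomials.KernelForm
import Literature.Combinatorics.StablePolynomials.Homogenization
import Literature.Combinatorics.StablePolynomials.GraceWalshSzego
import Literature.Combinatorics.LorentzianPolynomials.StronglyRayleighMeasures
import HarnessLib

/-!
# Strongly Rayleigh measures are negatively associated: symmetric homogenization (Thm. 4.2) and
# "strongly Rayleigh ⇒ CNA+" (Thm. 4.9) of Borcea–Brändén–Liggett

J. Borcea, P. Brändén, T. M. Liggett, *Negative dependence and the geometry of polynomials*, J. Amer. Math.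
Soc. 22 (2009) 521–567 (arXiv:0707.2340, held `paper:arxiv-0707.2340`; section / theorem numbers of the arXiv
version). Verbatim:

> (§2.1, Def. 2.7) A measure `μ ∈ 𝔓_n` is called *negatively associated* or NA if `∫F dμ ∫G dμ ≥ ∫FG dμ` for any
> increasing functions `F, G` on `2^[n]` that depend on disjoint sets of coordinates. One says that `μ` is
> *conditionally negatively associated* or CNA if each measure obtained from `μ` by conditioning on some (or
> none) of the values of the variables is NA. Finally, `μ` is called *strongly conditionally negatively
> associated* or CNA+ if each measure obtained from `μ` by imposing external fields and projections is CNA.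
> (§2.1 (ii)–(iv)) *Projections*: `g_μ|_{z_i = 1, i ∉ S}`. *Conditioning* `X_i = 0`: `g_μ|_{z_i=0} / (…)`;
> `X_i = 1`: `∂_i g_μ / ∂_i g_μ(1,…,1)`. *External fields*: `g_μ(a_1 z_1, …, a_n z_n) / g_μ(a_1,…,a_n)`, `a_i ≥ 0`
> (Remark 2.1: all these operations are well defined for arbitrary measures if one drops the normalization
> factors).
> (§2.2, Def. 2.9) A polynomial `f ∈ ℂ[z_1,…,z_n]` is called *stable* if `f(z_1,…,z_n) ≠ 0` whenever
> `Im(z_j) > 0` for `1 ≤ j ≤ n`. (Def. 2.10) A measure `μ ∈ 𝔓_n` is called *strongly Rayleigh* if its generating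
> polynomial `g_μ ∈ 𝔓_n` is (real) stable.
> (§2.3, Def. 2.12) Given a measure `μ ∈ 𝔓_n` define a new measure `μ_sh ∈ 𝔓_{2n}` called the *symmetric
> homogenization* of `μ` by `μ_sh(S) = μ(S ∩ [n]) binom(n, |S ∩ [n]|)^{-1}` if `|S| = n`, `0` otherwise. Note that
> `g_{μ_sh}(z_1,…,z_{2n}) = Σ_{S ⊆ [n]} μ(S) binom(n,|S|)^{-1} z^S e_{n-|S|}(z_{n+1},…,z_{2n})` […] and `μ_sh`
> projects to `μ`, that is, `g_{μ_sh}(z_1,…,z_n,1,…,1) = g_μ(z_1,…,z_n)`.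
>
> **Theorem 4.2.** If `μ ∈ 𝔓_n` is strongly Rayleigh then so is its symmetric homogenization `μ_sh ∈ 𝔓_{2n}`.
> *Proof* (after Cor. 4.7). Let `g` be the generating polynomial of `μ ∈ 𝔓_n` and suppose that `g` is stable of
> degree `d`. Then so is the homogenization `g_H` of `g` by Proposition 4.5. Now straightforward computations
> show that the generating polynomial of the symmetric homogenization `μ_sh ∈ 𝔓_{2n}` is given by
> `π(z_{n+1}^{n-d} g_H)`, so the theorem follows from Corollary 4.7 [`f` is stable iff its polarization `π(f)`
> is stable — Grace–Walsh–Szegő].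
>
> **Theorem 4.9.** If `μ ∈ 𝔓_n` is strongly Rayleigh then it is CNA+. *Proof.* Let `𝒮` be the class of all
> probability measures `μ` such that each `μ ∈ 𝒮` is a measure on `2^E`, where `E` is a finite subset of
> `{1,2,…}` depending on `μ`, and `μ` has a stable homogeneous generating polynomial. Since stable homogeneous
> polynomials are pairwise negatively correlated and are also closed under conditioning (cf. §2.1), the class
> `𝒮` satisfies all the hypotheses required in Theorem 4.8. Therefore, all the measures in `𝒮` are negatively
> associated. Let further `𝒮̂` be the class of all probability measures `μ` such that […] `μ` has a stable
> generating polynomial. Now by Theorem 4.2 every measure in `𝒮̂` is the projection of a measure in `𝒮`. Since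
> negative association is closed under projections and the strongly Rayleigh property is closed under
> conditioning and external fields, the theorem follows.

## Transposition

* As in `FederMihail.lean` (Theorem 4.8, `federMihail_negAssoc`): measures are unnormalised weights
  `μ : Finset σ → ℝ`, `μ ≥ 0`, on the subsets of a finite type `σ`; `ex μ F = Σ_S μ(S) F(S)`
  (`Literature.Combinatorics.Sahi2008.ex`), `mass μ = Σ_S μ(S)`, and NA is written cross-multiplied,
  `ex μ (FG) · mass μ ≤ ex μ F · ex μ G`; conditioning is `pin I O μ` (restriction to `I ⊆ S`, `O ∩ S = ∅`),
  external fields are `extField a μ (S) = μ(S) Π_{i∈S} a_i` (normalizations dropped, Remark 2.1).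
* "Strongly Rayleigh" is used in the form `StableOrZero μ`: the generating polynomial
  `Σ_S μ(S) z^S = multiAffine μ` (tree) is zero or stable — `stableOrZero_iff`; the zero weight is allowed so
  that the class is closed under every conditioning (BBL condition only when the denominators are non-zero).
  §5 identifies it with the tree's `Set`-indexed `IsStronglyRayleighMeasure` (the strong Rayleigh inequalities,
  `LorentzianPolynomials/StronglyRayleighMeasures.lean`) through Brändén's theorem already in the tree.
* `μ_sh` lives on `σ ⊕ σ` (first copy = `[n]`, second copy = `[2n] ∖ [n]`); we write `binom(n, |S ∖ [n]|)` for
  BBL's `binom(n, |S ∩ [n]|)` (equal when `|S| = n`). "Projection of `μ_sh` to `μ`" is the identity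
  `ex (symmHomog μ) (H ∘ toLeft) = ex μ H` (`ex_symmHomog_comp_toLeft`), which is all that "negative association
  is closed under projections" is used for; likewise a projection of `μ` onto `2^T` is NA as soon as `μ` is NA
  for functions determined by subsets of `T`, so projections need no separate statement in Theorem 4.9.
* Proof of Theorem 4.2, "straightforward computations": instead of the `2n`-variable identity
  `g_{μ_sh} = π(z_{n+1}^{n-d} g_H)` we freeze `z ∈ ℋⁿ` and use the univariate SECTION polynomial
  `q_z(t) = Σ_S μ(S) z^S t^{n-|S|} = g_H(z, t)` (`sectionPoly`; `= z_{n+1}^{n-d} g_H` up to the missing top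
  coefficients, `natDegree ≤ n`): `q_z(t) ≠ 0` for `t ∈ ℋ` by Thm. 4.5 (tree `IsRealStable.homogenize`, which needs
  the nonnegative coefficients `μ ≥ 0`), and `g_{μ_sh}(z, w) = π_n(q_z)(w)` (`sum_symmHomog_mul_prod_eq`, the tree's
  univariate `polarization`), which is non-zero on `ℋⁿ` by the tree's Grace–Walsh–Szegő corollary
  `isUpperHalfPlaneStable_polarization_iff` (= Cor. 4.7 in one block of variables).
* Proof of Theorem 4.9 exactly as printed: `StableOrZero` is closed under conditioning (`stableOrZero_pin`: `z_e ↦ 0`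
  by the tree's `multiAffine_stableOrZero_specialize`, `∂_e` by the tree's `IsUpperHalfPlaneStable.pderiv`) and is
  pairwise negatively correlated (tree `multiAffine_pairwise_negCorr`, Brändén), so a HOMOGENEOUS such weight is in
  the Feder–Mihail class `IsFederMihail` of Theorem 4.8 (`StableOrZero.isFederMihail`); `μ_sh` is homogeneous and
  stable-or-zero (Thm. 4.2), hence NA, hence `μ` is NA (`StableOrZero.negAssoc`); external fields and conditioning
  preserve `StableOrZero` (`stableOrZero_extField`, `stableOrZero_pin`), which gives CNA+
  (`StableOrZero.negAssoc_pin_extField`).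

## Contents

* §1 `StableOrZero`, `stableOrZero_iff`, closure under conditioning `stableOrZero_pinIn/pinOut/pin`, pairwise
  negative correlation `StableOrZero.isPairwiseNC`, `StableOrZero.isFederMihail` (homogeneous case).
* §2 `symmHomog` (Def. 2.12) with `symmHomog_disjSum`, `symmHomog_nonneg`, `isHomogeneous_symmHomog`,
  `sum_symmHomog_disjSum` (fibres of the projection), `ex_symmHomog_comp_toLeft`, `mass_symmHomog`.
* §3 Theorem 4.2: `sectionPoly`, `eval_sectionPoly_eq_eval_homogenize`, `eval_sectionPoly_ne_zero`,
  `sum_symmHomog_mul_prod_eq`, **`stableOrZero_symmHomog`**, `isFederMihail_symmHomog`.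
* §4 Theorem 4.9: **`StableOrZero.negAssoc`** (NA), `StableOrZero.negAssoc_of_mass_eq_one`,
  `StableOrZero.negAssoc_events`, `extField`, `stableOrZero_extField`, **`StableOrZero.negAssoc_pin_extField`** (CNA+).
* §5 `partitionPoly_eq_multiAffine`, `isStronglyRayleighMeasure_iff_stableOrZero`,
  `negAssoc_of_isStronglyRayleighMeasure`, `negAssoc_pin_extField_of_isStronglyRayleighMeasure`.

## References

* [BorceaBrandenLiggett2007] J. Borcea, P. Brändén, T. M. Liggett, Negative dependence and the geometry of
  polynomials, J. Amer. Math. Soc. 22 (2009), 521–567; arXiv:0707.2340.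
* [Branden2007] P. Brändén, Polynomials with the half-plane property and matroid theory, Adv. Math. 216 (2007),
  302–320 (strong Rayleigh inequalities ⟺ stability for multi-affine real polynomials).
* [LyonsPeres2016] R. Lyons, Y. Peres, Probability on Trees and Networks, CUP 2016, §4.2 (the Feder–Mihail
  argument formalized in `FederMihail.lean`).
-/

noncomputable section

open Finset MvPolynomial
open Literature.Combinatorics.Sahi2008
open Literature.Combinatorics.StablePolynomials

namespace Literature.Probability.NegativeDependence

variable {σ : Type*} [Fintype σ] [DecidableEq σ]

/-! ## §1 Weights with stable-or-zero generating polynomial ("strongly Rayleigh or zero") -/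

section StableOrZero

/-- **Stable or zero** (coefficient form): the generating polynomial `Σ_S μ(S) z^S` of the weight `μ` is
identically zero or has no zero in the open upper half-space `ℋ^σ` — for `μ ≥ 0`, `μ ≠ 0` this is "`μ` is
strongly Rayleigh" (BBL Def. 2.10: the generating polynomial is real stable; equivalently the strong Rayleigh
inequalities, Brändén's theorem), written in the function form of the tree's `multiAffine_pairwise_negCorr`.
[cite: BorceaBrandenLiggett2007, §2.2 Def. 2.9 (stable polynomials) and Def. 2.10 (strongly Rayleigh
measures)] -/
def StableOrZero (μ : Finset σ → ℝ) : Prop :=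
  (∀ S, μ S = 0) ∨ ∀ z : σ → ℂ, (∀ i, 0 < (z i).im) → (∑ S : Finset σ, (μ S : ℂ) * ∏ i ∈ S, z i) ≠ 0

omit [DecidableEq σ] in
/-- `StableOrZero μ` iff the generating polynomial `multiAffine μ` is `0` or real stable.
[cite: BorceaBrandenLiggett2007, §2.2 Def. 2.10] -/
theorem stableOrZero_iff (μ : Finset σ → ℝ) :
    StableOrZero μ ↔ multiAffine μ = 0 ∨ IsRealStable (multiAffine μ) := by
  rw [StableOrZero, isRealStable_multiAffine_iff]
  refine or_congr_left ⟨fun h => ?_, fun h S => ?_⟩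
  · have h' : multiAffine (fun S => (μ S : ℂ)) = 0 := (multiAffine_eq_zero_iff _).2 fun S => by simp [h S]
    have hmap : MvPolynomial.map (algebraMap ℝ ℂ) (multiAffine μ) = 0 := by
      rw [map_multiAffine]
      exact h'
    exact (MvPolynomial.map_injective _ (RingHom.injective _)) (by rw [hmap, map_zero])
  · have : (μ S : ℂ) = 0 := by
      have h' := (multiAffine_eq_zero_iff (fun S => (μ S : ℂ))).1 (by
        have := congrArg (MvPolynomial.map (algebraMap ℝ ℂ)) h
        rw [map_multiAffine, map_zero] at this
        exact this) S
      exact h'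
    exact_mod_cast this

omit [DecidableEq σ] in
/-- The zero weight. [cite: BorceaBrandenLiggett2007, §2.2 Def. 2.9] -/
theorem stableOrZero_zero : StableOrZero (0 : Finset σ → ℝ) := Or.inl fun _ => rfl

/-- **Conditioning on `e ∉ S` keeps "stable or zero"** (specialise `z_e := 0`; tree
`multiAffine_stableOrZero_specialize`). [cite: BorceaBrandenLiggett2007, §4.2 proof of Thm. 4.9 ("the strongly
Rayleigh property is closed under conditioning")] -/
theorem stableOrZero_pinOut {μ : Finset σ → ℝ} (h : StableOrZero μ) (e : σ) : StableOrZero (pinOut e μ) := by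
  have key := multiAffine_stableOrZero_specialize μ h e 0
  simp only [zero_mul, add_zero] at key
  refine key.imp (fun h1 S => ?_) (fun h2 z hz => ?_)
  · rw [pinOut_apply]
    exact h1 S
  · have h3 := h2 z hz
    simpa only [pinOut_apply] using h3

/-- Re-indexing the sets containing `e` by `T ↦ insert e T`, `T ∌ e`. [folklore] -/
private theorem sum_filter_mem_eq_sum_filter_not_mem_insert {M : Type*} [AddCommMonoid M] (e : σ)
    (f : Finset σ → M) :
    ∑ S ∈ univ.filter (fun S : Finset σ => e ∈ S), f S =
      ∑ T ∈ univ.filter (fun T : Finset σ => e ∉ T), f (insert e T) := by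
  have himage : (univ.filter (fun T : Finset σ => e ∉ T)).image (insert e) = univ.filter (fun S : Finset σ => e ∈ S) := by
    ext S
    simp only [mem_image, mem_filter, mem_univ, true_and]
    constructor
    · rintro ⟨T, -, rfl⟩
      exact mem_insert_self e T
    · intro heS
      exact ⟨S.erase e, Finset.notMem_erase e S, Finset.insert_erase heS⟩
  rw [← himage, Finset.sum_image]
  intro T hT T' hT' hTT'
  rw [Finset.coe_filter] at hT hT'
  have hT : e ∉ T := hT.2
  have hT' : e ∉ T' := hT'.2
  rw [← Finset.erase_insert hT, hTT', Finset.erase_insert hT']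

/-- **The generating polynomial of `μ` conditioned on `e ∈ S` is `z_e · ∂_e` of that of `μ`** (pointwise):
`Σ_{S ∋ e} μ(S) z^S = z_e · Σ_{T ∌ e} μ(T ∪ e) z^T`. [cite: BorceaBrandenLiggett2007, §2.1 (conditioning on
`X_e = 1`)] -/
theorem sum_pinIn_mul_prod (μ : Finset σ → ℝ) (e : σ) (z : σ → ℂ) :
    (∑ S : Finset σ, (pinIn e μ S : ℂ) * ∏ i ∈ S, z i) =
      z e * ∑ T : Finset σ, ((if e ∈ T then (0 : ℝ) else μ (insert e T) : ℝ) : ℂ) * ∏ i ∈ T, z i := by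
  have hL : (∑ S : Finset σ, (pinIn e μ S : ℂ) * ∏ i ∈ S, z i) =
      ∑ S ∈ univ.filter (fun S : Finset σ => e ∈ S), (μ S : ℂ) * ∏ i ∈ S, z i := by
    rw [Finset.sum_filter]
    refine Finset.sum_congr rfl fun S _ => ?_
    rw [pinIn_apply]
    split_ifs <;> simp
  have hR : (∑ T : Finset σ, ((if e ∈ T then (0 : ℝ) else μ (insert e T) : ℝ) : ℂ) * ∏ i ∈ T, z i) =
      ∑ T ∈ univ.filter (fun T : Finset σ => e ∉ T), (μ (insert e T) : ℂ) * ∏ i ∈ T, z i := by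
    rw [Finset.sum_filter]
    refine Finset.sum_congr rfl fun T _ => ?_
    split_ifs <;> simp
  rw [hL, hR, sum_filter_mem_eq_sum_filter_not_mem_insert, Finset.mul_sum]
  refine Finset.sum_congr rfl fun T hT => ?_
  have heT : e ∉ T := (mem_filter.1 hT).2
  rw [Finset.prod_insert heT]
  ring

/-- **Conditioning on `e ∈ S` keeps "stable or zero"** (`z_e ∂_e g` is stable or zero when `g` is: tree
`pderiv_multiAffine`, `IsUpperHalfPlaneStable.pderiv`). [cite: BorceaBrandenLiggett2007, §4.2 proof of
Thm. 4.9 ("the strongly Rayleigh property is closed under conditioning")] -/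
theorem stableOrZero_pinIn {μ : Finset σ → ℝ} (h : StableOrZero μ) (e : σ) : StableOrZero (pinIn e μ) := by
  rcases h with h | h
  · exact Or.inl fun S => by rw [pinIn_apply]; split_ifs <;> simp [h S]
  -- the derivative family
  set d : Finset σ → ℝ := fun T => if e ∈ T then 0 else μ (insert e T) with hd
  have hP : IsUpperHalfPlaneStable (multiAffine fun S => (μ S : ℂ)) :=
    (isUpperHalfPlaneStable_multiAffine_iff _).2 h
  have hder : MvPolynomial.pderiv e (multiAffine fun S => (μ S : ℂ)) = multiAffine fun T => (d T : ℂ) := by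
    rw [pderiv_multiAffine]
    congr 1
    funext T
    simp only [hd]
    split_ifs <;> simp
  rcases hP.pderiv e with h0 | hst
  · -- `∂_e g = 0`: then `μ(S) = 0` for every `S ∋ e`
    left
    intro S
    rw [pinIn_apply]
    split_ifs with heS
    · have hdz := (multiAffine_eq_zero_iff _).1 (hder ▸ h0) (S.erase e)
      have : (d (S.erase e) : ℂ) = μ S := by
        simp only [hd, Finset.notMem_erase, if_false, Finset.insert_erase heS]
      rw [this] at hdz
      exact_mod_cast hdz
    · rfl
  · right
    intro z hz
    rw [sum_pinIn_mul_prod]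
    refine mul_ne_zero (fun h0 => (hz e).ne' (by rw [h0, Complex.zero_im])) ?_
    have := (isUpperHalfPlaneStable_multiAffine_iff _).1 (hder ▸ hst) z hz
    simpa only [hd] using this

/-- **"Stable or zero" is closed under all conditionings.** [cite: BorceaBrandenLiggett2007, §4.2 proof of
Thm. 4.9] -/
theorem stableOrZero_pin {μ : Finset σ → ℝ} (h : StableOrZero μ) (I O : Finset σ) : StableOrZero (pin I O μ) := by
  induction I using Finset.induction_on with
  | empty =>
    induction O using Finset.induction_on with
    | empty => rwa [pin_empty_empty]
    | insert e O _ ih => rw [← pinOut_pin]; exact stableOrZero_pinOut ih e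
  | insert e I _ ih => rw [← pinIn_pin]; exact stableOrZero_pinIn ih e

/-- A "stable or zero" weight is pairwise negatively correlated (tree `multiAffine_pairwise_negCorr`, BBL §2.1).
[cite: BorceaBrandenLiggett2007, §4.2 proof of Thm. 4.9 ("stable homogeneous polynomials are pairwise negatively
correlated")] -/
theorem StableOrZero.isPairwiseNC {μ : Finset σ → ℝ} (h : StableOrZero μ) : IsPairwiseNC μ :=
  fun _ _ hxy => multiAffine_pairwise_negCorr μ h hxy

/-- **The class `𝒮` of Theorem 4.9**: a nonnegative homogeneous weight with stable (or zero) generating polynomial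
satisfies the hypotheses of the Feder–Mihail theorem. [cite: BorceaBrandenLiggett2007, §4.2 proof of Thm. 4.9
("the class `𝒮` satisfies all the hypotheses required in Theorem 4.8")] -/
theorem StableOrZero.isFederMihail {μ : Finset σ → ℝ} (h : StableOrZero μ) (h0 : ∀ S, 0 ≤ μ S)
    (hhom : IsHomogeneous μ) : IsFederMihail μ :=
  ⟨h0, hhom, fun I O => (stableOrZero_pin h I O).isPairwiseNC⟩

/-- **Negative association of homogeneous strongly Rayleigh weights** (the class `𝒮`).
[cite: BorceaBrandenLiggett2007, §4.2 proof of Thm. 4.9 ("all the measures in `𝒮` are negatively associated")] -/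
theorem StableOrZero.negAssoc_of_isHomogeneous {μ : Finset σ → ℝ} (h : StableOrZero μ) (h0 : ∀ S, 0 ≤ μ S)
    (hhom : IsHomogeneous μ) {F G : Finset σ → ℝ} (hF : Monotone F) (hG : Monotone G) {E₁ E₂ : Finset σ}
    (hFE : DeterminedBy F E₁) (hGE : DeterminedBy G E₂) (hdisj : Disjoint E₁ E₂) :
    ex μ (F * G) * mass μ ≤ ex μ F * ex μ G :=
  federMihail_negAssoc (h.isFederMihail h0 hhom) hF hG hFE hGE hdisj

end StableOrZero

/-! ## §2 The symmetric homogenization `μ_sh` (BBL §4.1) -/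

section SymmHomog

/-- **The symmetric homogenization** (BBL Def. 2.12) of a weight `μ` on `2^[n]`: the weight on `2^[2n]`
(ground set `σ ⊕ σ`) with `μ_sh(S ⊔ T) = μ(S) / binom(n, |T|)` if `|S| + |T| = n` and `0` otherwise (`S` in the
first copy, `T` in the second; `binom(n,|T|) = binom(n,|S|)` there, as printed).
[cite: BorceaBrandenLiggett2007, §2.3 Def. 2.12 (symmetric homogenization `μ_sh`)] -/
def symmHomog (μ : Finset σ → ℝ) : Finset (σ ⊕ σ) → ℝ := fun U =>
  if U.toLeft.card + U.toRight.card = Fintype.card σ then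
    μ U.toLeft / ((Fintype.card σ).choose U.toRight.card : ℝ) else 0

omit [DecidableEq σ] in
/-- Unfolding `symmHomog`. [cite: BorceaBrandenLiggett2007, §2.3 Def. 2.12] -/
theorem symmHomog_apply (μ : Finset σ → ℝ) (U : Finset (σ ⊕ σ)) :
    symmHomog μ U = if U.toLeft.card + U.toRight.card = Fintype.card σ then
      μ U.toLeft / ((Fintype.card σ).choose U.toRight.card : ℝ) else 0 := rfl

omit [DecidableEq σ] in
/-- `μ_sh` on `S ⊔ T`. [cite: BorceaBrandenLiggett2007, §2.3 Def. 2.12] -/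
theorem symmHomog_disjSum (μ : Finset σ → ℝ) (S T : Finset σ) :
    symmHomog μ (S.disjSum T) =
      if S.card + T.card = Fintype.card σ then μ S / ((Fintype.card σ).choose T.card : ℝ) else 0 := by
  rw [symmHomog_apply, Finset.toLeft_disjSum, Finset.toRight_disjSum]

omit [DecidableEq σ] in
/-- `μ_sh ≥ 0` for `μ ≥ 0`. [cite: BorceaBrandenLiggett2007, §2.3 Def. 2.12] -/
theorem symmHomog_nonneg {μ : Finset σ → ℝ} (h0 : ∀ S, 0 ≤ μ S) (U : Finset (σ ⊕ σ)) : 0 ≤ symmHomog μ U := by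
  rw [symmHomog_apply]
  split_ifs
  · exact div_nonneg (h0 _) (Nat.cast_nonneg _)
  · exact le_rfl

omit [DecidableEq σ] in
/-- **`μ_sh` is homogeneous of degree `n`** ("has a homogeneous generating polynomial").
[cite: BorceaBrandenLiggett2007, §4.1 (before Thm. 4.2)] -/
theorem isHomogeneous_symmHomog (μ : Finset σ → ℝ) : IsHomogeneous (symmHomog μ) := by
  refine ⟨Fintype.card σ, fun U hU => ?_⟩
  rw [symmHomog_apply] at hU
  split_ifs at hU with hc
  · rw [← Finset.card_toLeft_add_card_toRight]
    exact hc
  · exact absurd rfl hU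

omit [DecidableEq σ] in
/-- Sums over `2^{σ ⊔ σ}` as double sums over pairs `(S, T)`. [folklore] -/
private theorem sum_finset_sum_eq_sum_sum {M : Type*} [AddCommMonoid M] (f : Finset (σ ⊕ σ) → M) :
    ∑ U, f U = ∑ S : Finset σ, ∑ T : Finset σ, f (S.disjSum T) := by
  rw [← Fintype.sum_prod_type']
  exact Fintype.sum_equiv Finset.sumEquiv.toEquiv _ _ fun U => by
    simp [Finset.sumEquiv, Finset.toLeft_disjSum_toRight]

omit [DecidableEq σ] in
/-- The number of `k`-subsets of `σ`. [folklore] -/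
private theorem card_filter_card_eq (k : ℕ) :
    ((univ : Finset (Finset σ)).filter fun T => T.card = k).card = (Fintype.card σ).choose k := by
  rw [← Finset.powerset_univ, ← Finset.powersetCard_eq_filter, Finset.card_powersetCard, Finset.card_univ]

omit [DecidableEq σ] in
/-- **`μ` is the projection of `μ_sh` onto the first copy**: `Σ_T μ_sh(S ⊔ T) = μ(S)`.
[cite: BorceaBrandenLiggett2007, §4.2 proof of Thm. 4.9 ("every measure in `𝒮̂` is the projection of a measure
in `𝒮`")] -/
theorem sum_symmHomog_disjSum (μ : Finset σ → ℝ) (S : Finset σ) : ∑ T : Finset σ, symmHomog μ (S.disjSum T) = μ S := by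
  have hS : S.card ≤ Fintype.card σ := by rw [← Finset.card_univ]; exact Finset.card_le_univ S
  have hterm : ∀ T : Finset σ, symmHomog μ (S.disjSum T) =
      if T.card = Fintype.card σ - S.card then
        μ S / (((Fintype.card σ).choose (Fintype.card σ - S.card) : ℕ) : ℝ) else 0 := by
    intro T
    rw [symmHomog_disjSum]
    by_cases h : T.card = Fintype.card σ - S.card
    · rw [if_pos h, if_pos (by omega), h]
    · rw [if_neg h, if_neg (by omega)]
  rw [Finset.sum_congr rfl fun T _ => hterm T, ← Finset.sum_filter, Finset.sum_const, card_filter_card_eq,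
    nsmul_eq_mul]
  have hc : (((Fintype.card σ).choose (Fintype.card σ - S.card) : ℕ) : ℝ) ≠ 0 :=
    Nat.cast_ne_zero.2 (Nat.choose_pos (Nat.sub_le _ _)).ne'
  field_simp

omit [DecidableEq σ] in
/-- **Projection of expectations**: for `H` depending on the first copy only, `E_{μ_sh}[H] = E_μ[H]`.
[cite: BorceaBrandenLiggett2007, §4.2 proof of Thm. 4.9 ("negative association is closed under projections")] -/
theorem ex_symmHomog_comp_toLeft (μ : Finset σ → ℝ) (H : Finset σ → ℝ) :
    ex (symmHomog μ) (H ∘ Finset.toLeft) = ex μ H := by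
  rw [ex, ex, sum_finset_sum_eq_sum_sum]
  refine Finset.sum_congr rfl fun S _ => ?_
  simp only [Function.comp_apply, Finset.toLeft_disjSum]
  rw [← Finset.sum_mul, sum_symmHomog_disjSum]

omit [DecidableEq σ] in
/-- `μ_sh(Ω) = μ(Ω)`. [cite: BorceaBrandenLiggett2007, §2.3 Def. 2.12] -/
theorem mass_symmHomog (μ : Finset σ → ℝ) : mass (symmHomog μ) = mass μ := by
  have h := ex_symmHomog_comp_toLeft μ (fun _ => 1)
  simp only [ex, Function.comp_apply, mul_one] at h
  exact h

end SymmHomog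

/-! ## §3 Theorem 4.2: `μ_sh` is strongly Rayleigh when `μ` is -/

section Stability

omit [Fintype σ] [DecidableEq σ] in
/-- `z^S` as a monomial, any coefficients. [folklore] -/
private theorem prod_X_eq_monomial_sum_single {R : Type*} [CommSemiring R] (S : Finset σ) :
    (∏ i ∈ S, X i : MvPolynomial σ R) = monomial (∑ i ∈ S, Finsupp.single i 1) 1 := by
  classical
  induction S using Finset.induction_on with
  | empty => rw [Finset.prod_empty, Finset.sum_empty]; rfl
  | insert i S hi ih =>
    rw [Finset.prod_insert hi, Finset.sum_insert hi, ih, monomial_single_add, pow_one]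

omit [Fintype σ] [DecidableEq σ] in
/-- `|𝟙_S| = |S|`. [folklore] -/
private theorem degree_sum_single_one (S : Finset σ) :
    (∑ i ∈ S, Finsupp.single i 1 : σ →₀ ℕ).degree = S.card := by
  rw [map_sum, Finset.sum_congr rfl fun i _ => Finsupp.degree_single i 1, Finset.sum_const, smul_eq_mul, mul_one]

omit [DecidableEq σ] in
/-- The coefficients of the generating polynomial of a nonnegative weight are nonnegative.
[cite: BorceaBrandenLiggett2007, §4.1 Thm. 4.5 (hypothesis "all the coefficients … are non-negative")] -/
theorem coeff_multiAffine_nonneg {μ : Finset σ → ℝ} (h0 : ∀ S, 0 ≤ μ S) (m : σ →₀ ℕ) :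
    0 ≤ coeff m (multiAffine μ) := by
  classical
  rw [multiAffine, coeff_sum]
  refine Finset.sum_nonneg fun S _ => ?_
  rw [prod_X_eq_monomial_sum_single, C_mul_monomial, mul_one, coeff_monomial]
  split_ifs
  · exact h0 S
  · exact le_rfl

omit [DecidableEq σ] in
/-- `deg Σ_S μ(S) z^S ≤ n`. [cite: BorceaBrandenLiggett2007, §4.1 (`f_H` for `f` of degree `≤ n`)] -/
theorem totalDegree_multiAffine_le {R : Type*} [CommSemiring R] (a : Finset σ → R) :
    (multiAffine a).totalDegree ≤ Fintype.card σ := by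
  rw [multiAffine]
  refine totalDegree_finsetSum_le fun S _ => ?_
  rw [prod_X_eq_monomial_sum_single, C_mul_monomial, mul_one]
  refine (totalDegree_monomial_le _ _).trans ?_
  have h : ((∑ i ∈ S, Finsupp.single i 1 : σ →₀ ℕ).sum fun _ => id) =
      (∑ i ∈ S, Finsupp.single i 1 : σ →₀ ℕ).degree := rfl
  rw [h, degree_sum_single_one, ← Finset.card_univ]
  exact Finset.card_le_univ S

/-- **The section polynomial** `q_z(t) = Σ_S μ(S) z^S t^{n-|S|} = t^n g(z/t) = g_H(z,t)` (the homogenized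
generating polynomial with the `z`-variables frozen). [cite: BorceaBrandenLiggett2007, §4.1 proof of Thm. 4.2
("the generating polynomial of `μ_sh` is given by `π(z_{n+1}^{n-d} g_H)`")] -/
def sectionPoly (μ : Finset σ → ℝ) (z : σ → ℂ) : Polynomial ℂ :=
  ∑ S : Finset σ, Polynomial.C ((μ S : ℂ) * ∏ i ∈ S, z i) * Polynomial.X ^ (Fintype.card σ - S.card)

omit [DecidableEq σ] in
/-- `deg q_z ≤ n`. [cite: BorceaBrandenLiggett2007, §4.1 proof of Thm. 4.2] -/
theorem natDegree_sectionPoly_le (μ : Finset σ → ℝ) (z : σ → ℂ) :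
    (sectionPoly μ z).natDegree ≤ Fintype.card σ :=
  Polynomial.natDegree_sum_le_of_forall_le _ _ fun _ _ =>
    (Polynomial.natDegree_C_mul_X_pow_le _ _).trans (Nat.sub_le _ _)

omit [DecidableEq σ] in
/-- The coefficients of `q_z`. [cite: BorceaBrandenLiggett2007, §4.1 proof of Thm. 4.2] -/
theorem coeff_sectionPoly (μ : Finset σ → ℝ) (z : σ → ℂ) (k : ℕ) :
    (sectionPoly μ z).coeff k =
      ∑ S : Finset σ, if Fintype.card σ - S.card = k then (μ S : ℂ) * ∏ i ∈ S, z i else 0 := by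
  rw [sectionPoly, Polynomial.finsetSum_coeff]
  refine Finset.sum_congr rfl fun S _ => ?_
  rw [Polynomial.coeff_C_mul_X_pow]
  simp only [eq_comm]

omit [DecidableEq σ] in
/-- Evaluating `q_z`. [cite: BorceaBrandenLiggett2007, §4.1 proof of Thm. 4.2] -/
theorem eval_sectionPoly (μ : Finset σ → ℝ) (z : σ → ℂ) (t : ℂ) :
    (sectionPoly μ z).eval t = ∑ S : Finset σ, (μ S : ℂ) * (∏ i ∈ S, z i) * t ^ (Fintype.card σ - S.card) := by
  rw [sectionPoly, Polynomial.eval_finsetSum]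
  simp only [Polynomial.eval_mul, Polynomial.eval_C, Polynomial.eval_pow, Polynomial.eval_X]

omit [DecidableEq σ] in
/-- **`q_z(t)` is the homogenized generating polynomial at `(z, t)`.**
[cite: BorceaBrandenLiggett2007, §4.1 proof of Thm. 4.2 (`g_H`)] -/
theorem eval_sectionPoly_eq_eval_homogenize (μ : Finset σ → ℝ) (z : σ → ℂ) (t : ℂ) :
    (sectionPoly μ z).eval t = MvPolynomial.eval (fun o : Option σ => o.elim t z)
      (MvPolynomial.map (algebraMap ℝ ℂ) (homogenize (Fintype.card σ) (multiAffine μ))) := by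
  classical
  rw [map_homogenize (RingHom.injective _), map_multiAffine, eval_sectionPoly]
  simp only [multiAffine, homogenize_sum, map_sum]
  refine Finset.sum_congr rfl fun S _ => ?_
  rw [prod_X_eq_monomial_sum_single, C_mul_monomial, mul_one, homogenize_monomial, eval_monomial,
    Finsupp.prod_option_index _ _ (fun _ => pow_zero _) (fun _ _ _ => pow_add _ _ _),
    Finsupp.optionElim_apply_none, Finsupp.some_optionElim, degree_sum_single_one]
  have hprod : ((∑ i ∈ S, Finsupp.single i 1 : σ →₀ ℕ).prod fun i e => ((fun o : Option σ => o.elim t z)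
      (some i)) ^ e) = ∏ i ∈ S, z i := by
    have h := congrArg (MvPolynomial.eval z) (prod_X_eq_monomial_sum_single (R := ℂ) S)
    rw [map_prod, eval_monomial, one_mul] at h
    simp only [eval_X] at h
    exact h.symm
  rw [hprod]
  simp only [Option.elim, Complex.coe_algebraMap, Function.comp_apply]
  ring

omit [DecidableEq σ] in
/-- **`q_z(t) ≠ 0` for `z ∈ ℋⁿ`, `t ∈ ℋ`** when `μ ≥ 0` has a real stable generating polynomial (BBL Thm. 4.5:
`g_H` is stable; tree `IsRealStable.homogenize`). [cite: BorceaBrandenLiggett2007, §4.1 proof of Thm. 4.2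
("Then so is the homogenization `g_H` of `g` by Proposition 4.5")] -/
theorem eval_sectionPoly_ne_zero {μ : Finset σ → ℝ} (h0 : ∀ S, 0 ≤ μ S) (hst : IsRealStable (multiAffine μ))
    {z : σ → ℂ} (hz : ∀ i, 0 < (z i).im) {t : ℂ} (ht : 0 < t.im) : (sectionPoly μ z).eval t ≠ 0 := by
  rw [eval_sectionPoly_eq_eval_homogenize]
  have hH : IsRealStable (homogenize (Fintype.card σ) (multiAffine μ)) :=
    hst.homogenize (coeff_multiAffine_nonneg h0) (totalDegree_multiAffine_le μ)
  refine hH _ fun o => ?_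
  cases o with
  | none => exact ht
  | some i => exact hz i

omit [DecidableEq σ] in
/-- Evaluating an elementary symmetric polynomial. [folklore] -/
private theorem eval_esymm (w : σ → ℂ) (k : ℕ) :
    MvPolynomial.eval w (MvPolynomial.esymm σ ℂ k) = ∑ T ∈ powersetCard k univ, ∏ j ∈ T, w j := by
  rw [MvPolynomial.esymm, map_sum]
  refine Finset.sum_congr rfl fun T _ => ?_
  rw [map_prod]
  simp only [eval_X]

omit [DecidableEq σ] in
/-- **The generating polynomial of `μ_sh` at `(z, w)` is the polarization of `q_z` at `w`:**
`Σ_U μ_sh(U) (z,w)^U = Σ_k [t^k]q_z · e_k(w)/binom(n,k) = (π q_z)(w)`. [cite: BorceaBrandenLiggett2007, §4.1 proof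
of Thm. 4.2 ("the generating polynomial of the symmetric homogenization `μ_sh` is given by `π(z_{n+1}^{n-d} g_H)`")] -/
theorem sum_symmHomog_mul_prod_eq (μ : Finset σ → ℝ) (v : σ ⊕ σ → ℂ) :
    (∑ U : Finset (σ ⊕ σ), (symmHomog μ U : ℂ) * ∏ u ∈ U, v u) =
      MvPolynomial.eval (fun j => v (Sum.inr j)) (polarization σ (sectionPoly μ fun i => v (Sum.inl i))) := by
  set n := Fintype.card σ with hn
  set z : σ → ℂ := fun i => v (Sum.inl i)
  set w : σ → ℂ := fun j => v (Sum.inr j)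
  -- the left side as a double sum
  have hL : (∑ U : Finset (σ ⊕ σ), (symmHomog μ U : ℂ) * ∏ u ∈ U, v u) =
      ∑ S : Finset σ, ∑ T : Finset σ, if S.card + T.card = n then
        (μ S : ℂ) * (∏ i ∈ S, z i) / ((n.choose T.card : ℕ) : ℂ) * ∏ j ∈ T, w j else 0 := by
    rw [sum_finset_sum_eq_sum_sum]
    refine Finset.sum_congr rfl fun S _ => Finset.sum_congr rfl fun T _ => ?_
    rw [symmHomog_disjSum, Finset.prod_disjSum]
    split_ifs
    · push_cast
      ring
    · push_cast
      ring
  -- the right side as a double sum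
  have hR : MvPolynomial.eval w (polarization σ (sectionPoly μ z)) =
      ∑ T : Finset σ, ∑ S : Finset σ, if S.card + T.card = n then
        (μ S : ℂ) * (∏ i ∈ S, z i) / ((n.choose T.card : ℕ) : ℂ) * ∏ j ∈ T, w j else 0 := by
    rw [polarization, map_sum]
    have hS : ∀ S : Finset σ, S.card ≤ n := fun S => by rw [hn, ← Finset.card_univ]; exact Finset.card_le_univ S
    have hk : ∀ k ∈ range (n + 1), MvPolynomial.eval w ((((sectionPoly μ z).coeff k) /
        (((n.choose k : ℕ) : ℂ))) • MvPolynomial.esymm σ ℂ k) =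
        ∑ T ∈ powersetCard k univ, ∑ S : Finset σ, if S.card + T.card = n then
          (μ S : ℂ) * (∏ i ∈ S, z i) / ((n.choose T.card : ℕ) : ℂ) * ∏ j ∈ T, w j else 0 := by
      intro k _
      rw [smul_eval, eval_esymm, Finset.mul_sum]
      refine Finset.sum_congr rfl fun T hT => ?_
      have hTk : T.card = k := (Finset.mem_powersetCard.1 hT).2
      rw [coeff_sectionPoly, Finset.sum_div, Finset.sum_mul]
      refine Finset.sum_congr rfl fun S _ => ?_
      have hiff : Fintype.card σ - S.card = k ↔ S.card + T.card = n := by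
        have := hS S
        omega
      by_cases h : S.card + T.card = n
      · rw [if_pos (hiff.2 h), if_pos h, hTk]
      · rw [if_neg (mt hiff.1 h), if_neg h, zero_div, zero_mul]
    rw [Finset.sum_congr rfl hk, hn, ← Finset.card_univ, ← Finset.sum_powerset, Finset.powerset_univ]
  rw [hL, hR, Finset.sum_comm]

omit [DecidableEq σ] in
/-- **Borcea–Brändén–Liggett, Theorem 4.2.** "If `μ ∈ 𝔓_n` is strongly Rayleigh then so is its symmetric
homogenization `μ_sh ∈ 𝔓_{2n}`": for `μ ≥ 0` with stable (or zero) generating polynomial, `μ_sh` has stable (or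
zero) generating polynomial. Proof as printed: the generating polynomial of `μ_sh` is the polarization, in the
homogenizing variable, of `z_{n+1}^{n-d} g_H`, which is stable by Thm. 4.5 (tree `IsRealStable.homogenize`); the
polarization of a stable polynomial is stable by Grace–Walsh–Szegő (Cor. 4.7, tree
`isUpperHalfPlaneStable_polarization_iff`). [cite: BorceaBrandenLiggett2007, §4.1 Thm. 4.2 and its proof
(after Cor. 4.7)] -/
theorem stableOrZero_symmHomog {μ : Finset σ → ℝ} (h : StableOrZero μ) (h0 : ∀ S, 0 ≤ μ S) :
    StableOrZero (symmHomog μ) := by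
  classical
  rcases h with hzero | hne
  · left
    intro U
    rw [symmHomog_apply, hzero]
    simp
  · right
    intro v hv
    have hst : IsRealStable (multiAffine μ) := (isRealStable_multiAffine_iff μ).2 hne
    rw [sum_symmHomog_mul_prod_eq]
    have hpol : IsUpperHalfPlaneStable (polarization σ (sectionPoly μ fun i => v (Sum.inl i))) :=
      (isUpperHalfPlaneStable_polarization_iff (natDegree_sectionPoly_le μ _)).2 fun t ht =>
        eval_sectionPoly_ne_zero h0 hst (fun i => hv (Sum.inl i)) ht
    exact hpol _ fun j => hv (Sum.inr j)

/-- `μ_sh` belongs to the Feder–Mihail class `𝒮` of Theorem 4.9. [cite: BorceaBrandenLiggett2007, §4.2 proof of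
Thm. 4.9] -/
theorem isFederMihail_symmHomog {μ : Finset σ → ℝ} (h : StableOrZero μ) (h0 : ∀ S, 0 ≤ μ S) :
    IsFederMihail (symmHomog μ) := by
  classical
  exact (stableOrZero_symmHomog h h0).isFederMihail (symmHomog_nonneg h0) (isHomogeneous_symmHomog μ)

end Stability

/-! ## §4 Theorem 4.9: strongly Rayleigh measures are negatively associated (CNA+) -/

section NegAssoc

omit [Fintype σ] [DecidableEq σ] in
/-- Lifting a function on `2^σ` to `2^{σ ⊔ σ}` through the first copy keeps monotonicity. [folklore] -/
private theorem monotone_comp_toLeft {F : Finset σ → ℝ} (hF : Monotone F) :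
    Monotone (F ∘ (Finset.toLeft : Finset (σ ⊕ σ) → Finset σ)) :=
  hF.comp Finset.toLeft_monotone

omit [Fintype σ] in
/-- Lifting keeps the dependency set (embedded in the first copy). [cite: BorceaBrandenLiggett2007, §4.2 proof
of Thm. 4.9 ("negative association is closed under projections")] -/
theorem DeterminedBy.comp_toLeft {F : Finset σ → ℝ} {E : Finset σ} (hF : DeterminedBy F E) :
    DeterminedBy (F ∘ (Finset.toLeft : Finset (σ ⊕ σ) → Finset σ)) (E.map Function.Embedding.inl) := by
  intro U V hUV
  simp only [Function.comp_apply]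
  refine hF _ _ ?_
  have h := congrArg Finset.toLeft hUV
  rw [Finset.toLeft_inter, Finset.toLeft_inter] at h
  have hE : (E.map Function.Embedding.inl : Finset (σ ⊕ σ)).toLeft = E := by
    ext x
    simp
  rwa [hE] at h

/-- **Borcea–Brändén–Liggett, Theorem 4.9 (negative association).** "If `μ ∈ 𝔓_n` is strongly Rayleigh then it is
CNA+" — the NA core: for a weight `μ ≥ 0` on `2^E` whose generating polynomial `Σ_S μ(S) z^S` is real stable (or
zero), any two increasing functions depending on disjoint sets of coordinates satisfy
`E[FG] · μ(Ω) ≤ E[F] · E[G]`. Proof as printed: `μ` is the projection of its symmetric homogenization `μ_sh`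
(Thm. 4.2), which lies in the class `𝒮` of Theorem 4.8. [cite: BorceaBrandenLiggett2007, §4.2 Thm. 4.9] -/
theorem StableOrZero.negAssoc {μ : Finset σ → ℝ} (h : StableOrZero μ) (h0 : ∀ S, 0 ≤ μ S) {F G : Finset σ → ℝ}
    (hF : Monotone F) (hG : Monotone G) {E₁ E₂ : Finset σ} (hFE : DeterminedBy F E₁) (hGE : DeterminedBy G E₂)
    (hdisj : Disjoint E₁ E₂) : ex μ (F * G) * mass μ ≤ ex μ F * ex μ G := by
  have key := federMihail_negAssoc (isFederMihail_symmHomog h h0) (monotone_comp_toLeft hF)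
    (monotone_comp_toLeft hG) hFE.comp_toLeft hGE.comp_toLeft ((Finset.disjoint_map _).2 hdisj)
  rwa [show ((F ∘ Finset.toLeft) * (G ∘ Finset.toLeft) : Finset (σ ⊕ σ) → ℝ) = (F * G) ∘ Finset.toLeft from rfl,
    ex_symmHomog_comp_toLeft, ex_symmHomog_comp_toLeft, ex_symmHomog_comp_toLeft, mass_symmHomog] at key

/-- Theorem 4.9 for probability weights: `E[FG] ≤ E[F] E[G]`. [cite: BorceaBrandenLiggett2007, §4.2 Thm. 4.9;
§2.1 Def. 2.7 (negative association)] -/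
theorem StableOrZero.negAssoc_of_mass_eq_one {μ : Finset σ → ℝ} (h : StableOrZero μ) (h0 : ∀ S, 0 ≤ μ S)
    (h1 : mass μ = 1) {F G : Finset σ → ℝ} (hF : Monotone F) (hG : Monotone G) {E₁ E₂ : Finset σ}
    (hFE : DeterminedBy F E₁) (hGE : DeterminedBy G E₂) (hdisj : Disjoint E₁ E₂) :
    ex μ (F * G) ≤ ex μ F * ex μ G := by
  have key := h.negAssoc h0 hF hG hFE hGE hdisj
  rwa [h1, mul_one] at key

/-- Theorem 4.9 for increasing events: `μ(𝒜 ∩ ℬ) μ(Ω) ≤ μ(𝒜) μ(ℬ)` for up-sets depending on disjoint coordinate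
sets. [cite: BorceaBrandenLiggett2007, §4.2 Thm. 4.9; §2.1 (negatively associated events)] -/
theorem StableOrZero.negAssoc_events {μ : Finset σ → ℝ} (h : StableOrZero μ) (h0 : ∀ S, 0 ≤ μ S)
    {𝒜 ℬ : Finset (Finset σ)} (h𝒜 : IsUpperSet (𝒜 : Set (Finset σ))) (hℬ : IsUpperSet (ℬ : Set (Finset σ)))
    {E₁ E₂ : Finset σ} (h𝒜E : DeterminedBy (setInd 𝒜) E₁) (hℬE : DeterminedBy (setInd ℬ) E₂)
    (hdisj : Disjoint E₁ E₂) : (∑ S ∈ 𝒜 ∩ ℬ, μ S) * mass μ ≤ (∑ S ∈ 𝒜, μ S) * ∑ S ∈ ℬ, μ S := by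
  have key := h.negAssoc h0 (monotone_setInd h𝒜) (monotone_setInd hℬ) h𝒜E hℬE hdisj
  have hex : ∀ 𝒞 : Finset (Finset σ), ex μ (setInd 𝒞) = ∑ S ∈ 𝒞, μ S := fun 𝒞 => by
    simp only [ex, setInd_apply, mul_ite, mul_one, mul_zero]
    rw [Finset.sum_ite_mem, Finset.univ_inter]
  rwa [setInd_mul, hex, hex, hex] at key

/-- **External field** `μ^a(S) = μ(S) Π_{i ∈ S} a_i` (`a_i > 0`), i.e. the substitution `z_i ↦ a_i z_i` in the
generating polynomial. [cite: BorceaBrandenLiggett2007, §2.1 (external fields; CNA+)] -/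
def extField (a : σ → ℝ) (μ : Finset σ → ℝ) : Finset σ → ℝ := fun S => μ S * ∏ i ∈ S, a i

omit [Fintype σ] [DecidableEq σ] in
/-- Unfolding `extField`. [cite: BorceaBrandenLiggett2007, §2.1] -/
theorem extField_apply (a : σ → ℝ) (μ : Finset σ → ℝ) (S : Finset σ) : extField a μ S = μ S * ∏ i ∈ S, a i := rfl

omit [Fintype σ] [DecidableEq σ] in
/-- External fields keep nonnegativity. [cite: BorceaBrandenLiggett2007, §2.1] -/
theorem extField_nonneg {μ : Finset σ → ℝ} (h0 : ∀ S, 0 ≤ μ S) {a : σ → ℝ} (ha : ∀ i, 0 ≤ a i) (S : Finset σ) :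
    0 ≤ extField a μ S :=
  mul_nonneg (h0 S) (Finset.prod_nonneg fun i _ => ha i)

/-- An external field with zeros is a positive external field after conditioning the zero-field coordinates out.
[cite: BorceaBrandenLiggett2007, §2.1 (iii), (iv)] -/
theorem extField_eq_extField_pin (a : σ → ℝ) (μ : Finset σ → ℝ) :
    extField a μ = extField (fun i => if a i = 0 then 1 else a i) (pin ∅ (univ.filter fun i => a i = 0) μ) := by
  funext S
  rw [extField_apply, extField_apply, pin_apply]
  by_cases hS : ∃ i ∈ S, a i = 0
  · obtain ⟨i, hi, hai⟩ := hS
    have hnd : ¬Disjoint (univ.filter fun i => a i = 0) S :=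
      fun hd => Finset.disjoint_left.1 hd (Finset.mem_filter.2 ⟨Finset.mem_univ i, hai⟩) hi
    rw [Finset.prod_eq_zero hi hai, mul_zero, if_neg fun h => hnd h.2, zero_mul]
  · push Not at hS
    have hd : Disjoint (univ.filter fun i => a i = 0) S :=
      Finset.disjoint_left.2 fun i hi hiS => hS i hiS (Finset.mem_filter.1 hi).2
    rw [if_pos ⟨Finset.empty_subset S, hd⟩]
    exact congrArg _ (Finset.prod_congr rfl fun i hi => by rw [if_neg (hS i hi)])

omit [DecidableEq σ] in
/-- Positive rescaling of the variables preserves "stable or zero". [cite: BorceaBrandenLiggett2007, §4.2 proof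
of Thm. 4.9 (last sentence: "the strongly Rayleigh property is closed under … external fields")] -/
theorem stableOrZero_extField_of_pos {μ : Finset σ → ℝ} (h : StableOrZero μ) {a : σ → ℝ} (ha : ∀ i, 0 < a i) :
    StableOrZero (extField a μ) := by
  rcases h with hz | hne
  · exact Or.inl fun S => by rw [extField_apply, hz S, zero_mul]
  · right
    intro z hz
    have key := hne (fun i => (a i : ℂ) * z i) fun i => by
      rw [Complex.mul_im, Complex.ofReal_re, Complex.ofReal_im, zero_mul, add_zero]
      exact mul_pos (ha i) (hz i)
    have hterm : ∀ S : Finset σ, (extField a μ S : ℂ) * ∏ i ∈ S, z i = (μ S : ℂ) * ∏ i ∈ S, ((a i : ℂ) * z i) := by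
      intro S
      rw [extField_apply, Finset.prod_mul_distrib]
      push_cast
      ring
    simpa only [hterm] using key

/-- **"The strongly Rayleigh property is closed under external fields"** (`a_i ≥ 0`, BBL §2.1 (iv)).
[cite: BorceaBrandenLiggett2007, §4.2 proof of Thm. 4.9 (last sentence); §2.1 (iv)] -/
theorem stableOrZero_extField {μ : Finset σ → ℝ} (h : StableOrZero μ) {a : σ → ℝ} (ha : ∀ i, 0 ≤ a i) :
    StableOrZero (extField a μ) := by
  rw [extField_eq_extField_pin]
  exact stableOrZero_extField_of_pos (stableOrZero_pin h _ _) fun i => by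
    by_cases hi : a i = 0
    · rw [if_pos hi]; exact one_pos
    · rw [if_neg hi]; exact lt_of_le_of_ne (ha i) (Ne.symm hi)

/-- **Borcea–Brändén–Liggett, Theorem 4.9 (CNA+).** "If `μ ∈ 𝔓_n` is strongly Rayleigh then it is CNA+": every
weight obtained from a nonnegative weight with stable (or zero) generating polynomial by imposing an external
field and conditioning is negatively associated ("the strongly Rayleigh property is closed under conditioning
and external fields"). [cite: BorceaBrandenLiggett2007, §4.2 Thm. 4.9; §2.1 (CNA+)] -/
theorem StableOrZero.negAssoc_pin_extField {μ : Finset σ → ℝ} (h : StableOrZero μ) (h0 : ∀ S, 0 ≤ μ S)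
    {a : σ → ℝ} (ha : ∀ i, 0 ≤ a i) (I O : Finset σ) {F G : Finset σ → ℝ} (hF : Monotone F) (hG : Monotone G)
    {E₁ E₂ : Finset σ} (hFE : DeterminedBy F E₁) (hGE : DeterminedBy G E₂) (hdisj : Disjoint E₁ E₂) :
    ex (pin I O (extField a μ)) (F * G) * mass (pin I O (extField a μ)) ≤
      ex (pin I O (extField a μ)) F * ex (pin I O (extField a μ)) G :=
  (stableOrZero_pin (stableOrZero_extField h ha) I O).negAssoc (pin_nonneg (extField_nonneg h0 ha) I O) hF hG hFE hGE
    hdisj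

end NegAssoc

/-! ## §5 Bridge to the tree's `Set`-indexed strongly Rayleigh measures (`IsStronglyRayleighMeasure`) -/

section Bridge

open Literature.Combinatorics.LorentzianPolynomials

omit [DecidableEq σ] in
/-- The tree's partition function `Z_μ = Σ_S μ(S) w^S` (`partitionPoly`, weights on `Set σ`) is the generating
polynomial `multiAffine` of the same weight read on `Finset σ`. [cite: BorceaBrandenLiggett2007, §2.1 (the
generating polynomial `g_μ(z) = Σ_S μ(S) z^S`)] -/
theorem partitionPoly_eq_multiAffine (μ : Set σ → ℝ) :
    partitionPoly μ = multiAffine (fun S : Finset σ => μ ↑S) := by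
  classical
  rw [partitionPoly_def, multiAffine]
  refine (Fintype.sum_equiv Fintype.finsetEquivSet _ _ fun T => ?_).symm
  rw [Fintype.finsetEquivSet_apply, prod_X_eq_monomial_sum_single, C_mul_monomial, mul_one, indSet_def, ind_def,
    Finset.finite_toSet_toFinset]

/-- **BBL Def. 2.10 ⟺ "stable or zero".** A `Set`-indexed weight is strongly Rayleigh in the sense of the tree
(`IsStronglyRayleighMeasure`: the strong Rayleigh inequalities on `ℝⁿ`, Brändén's theorem) iff its generating
polynomial is zero or stable. [cite: BorceaBrandenLiggett2007, §2.2 Def. 2.10 and Thm. (stable-Rayleigh)]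
[cite: Branden2007, §5 Thm. 5.6] -/
theorem isStronglyRayleighMeasure_iff_stableOrZero (μ : Set σ → ℝ) :
    IsStronglyRayleighMeasure μ ↔ StableOrZero (fun S : Finset σ => μ ↑S) := by
  rw [stableOrZero_iff, ← partitionPoly_eq_multiAffine]
  refine ⟨fun h => h.eq_zero_or_isRealStable, fun h => ?_⟩
  rcases h with h0 | hst
  · rw [(partitionPoly_eq_zero_iff μ).1 h0]
    exact isStronglyRayleighMeasure_zero
  · exact isStronglyRayleighMeasure_of_isRealStable hst

/-- **Borcea–Brändén–Liggett, Theorem 4.9, in the tree's vocabulary**: a nonnegative strongly Rayleigh weight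
(`IsStronglyRayleighMeasure`) is negatively associated — `E[FG] · μ(Ω) ≤ E[F] · E[G]` for increasing `F, G`
depending on disjoint coordinate sets. [cite: BorceaBrandenLiggett2007, §4.2 Thm. 4.9] -/
theorem negAssoc_of_isStronglyRayleighMeasure {μ : Set σ → ℝ} (h : IsStronglyRayleighMeasure μ)
    (h0 : ∀ S, 0 ≤ μ S) {F G : Finset σ → ℝ} (hF : Monotone F) (hG : Monotone G) {E₁ E₂ : Finset σ}
    (hFE : DeterminedBy F E₁) (hGE : DeterminedBy G E₂) (hdisj : Disjoint E₁ E₂) :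
    ex (fun S : Finset σ => μ ↑S) (F * G) * mass (fun S : Finset σ => μ ↑S) ≤
      ex (fun S : Finset σ => μ ↑S) F * ex (fun S : Finset σ => μ ↑S) G :=
  ((isStronglyRayleighMeasure_iff_stableOrZero μ).1 h).negAssoc (fun _ => h0 _) hF hG hFE hGE hdisj

/-- … and CNA+: after any external field `a > 0` and any conditioning `(I in, O out)` the weight stays negatively
associated. [cite: BorceaBrandenLiggett2007, §4.2 Thm. 4.9; §2.1 Def. 2.7 (CNA+)] -/
theorem negAssoc_pin_extField_of_isStronglyRayleighMeasure {μ : Set σ → ℝ} (h : IsStronglyRayleighMeasure μ)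
    (h0 : ∀ S, 0 ≤ μ S) {a : σ → ℝ} (ha : ∀ i, 0 ≤ a i) (I O : Finset σ) {F G : Finset σ → ℝ} (hF : Monotone F)
    (hG : Monotone G) {E₁ E₂ : Finset σ} (hFE : DeterminedBy F E₁) (hGE : DeterminedBy G E₂)
    (hdisj : Disjoint E₁ E₂) :
    ex (pin I O (extField a fun S : Finset σ => μ ↑S)) (F * G) * mass (pin I O (extField a fun S : Finset σ => μ ↑S)) ≤
      ex (pin I O (extField a fun S : Finset σ => μ ↑S)) F * ex (pin I O (extField a fun S : Finset σ => μ ↑S)) G :=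
  ((isStronglyRayleighMeasure_iff_stableOrZero μ).1 h).negAssoc_pin_extField (fun _ => h0 _) ha I O hF hG hFE hGE
    hdisj

end Bridge

end Literature.Probability.NegativeDependence

end
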